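/-
Speedrun cell sr-mbsolver / programme hubbard-alg — LIT team (lit-1 gen-15), for the RAWLOW rows of the D6 lane (FORMAT-ksdn v0.5
`relax.type = "mps-rawlow"`, first signed row CERTIFIED #349, ref-1 R1.86): lane-B / L3-D6 transport, PRIMAL form, MODEL-INDEPENDENT core, with the
RAW HEAD BLOCK AT A GENERAL LEVEL `j + 1` (v0.4 `mps` = the case `j = 2`: raw `ρ₃`, injection `W₂`; v0.5 χ8 = `j = 4`: raw `ρ₅`, injection `W₄`;
χ16 = `j = 5`). Theorem-only.
HONEST FRAMING: first certified bounds; not a superconductivity verdict; every number certified or labelled float.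

WHAT THIS GIVES. `exists_mpsRawRowsTr_of_window`: for any local dimension `q`, any real charge-covariant MPS tensor `A`, any raw level `j ≥ 2`, any
a-priori bounds `B_m ≥ 0` with `‖T^{m−2}‖_F² ≤ B_m²` (levels `m ≥ j + 2`), and any `N = m'+2 ≥ j+2`-site window variable `ρ` that is PSD with trace one,
locally translation invariant, block diagonal in the total charge and entrywise real, THERE IS a family `ω` (KSDN's `ω_m = C_{m−2}(ρ|_{first m})`)
satisfying every `ω`-row of the `mps-rawlow` relaxation relative to the raw head marginal `ρ_{j+1} = ρ|_{first j+1}`: E_{j+2}L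
`tr_{s_L} ω_{j+2} = (W_j ⊗ 𝟙) ρ_{j+1} (W_j ⊗ 𝟙)ᴴ`, E_{j+2}R `tr_{s_R} ω_{j+2} = (𝟙 ⊗ W_j) ρ_{j+1} (𝟙 ⊗ W_j)ᴴ`, E_mL / E_mR (`m = k+j+3 ≤ N`), `ω_m ⪰ 0`, the
`cgTag` sector zeros, real entries, `|ω_m| ≤ B_m` AND the trace bounds `Re tr ω_m ≤ B_m` (`m = k+j+2 ≤ N`) — with `W_j = cgMap A j`, `L = leftMap A`,
`R = rightMap A`. This is `exists_mpsRowsTr_of_window` (`Transport/MPSPrimalSrotTrace.lean`, the case `j = 2`) with `2 → j` throughout; every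
Literature lemma used there already takes the level as a parameter, so the proof is the same text. The `jw-srot` wrapper (ρ₅ on `{-1,…,3}`) and the
Rows-side node for rawlow certificates are the next files (design `HOME/sr-mbsolver-lit-1/lean/g15/READY-LEAN-349.md`); the `lmax_psd` bound rule
of the `.lmax` instances (CERTIFIED #349) is the second theorem `exists_mpsRawRowsTr_of_window_loewner` (hypothesis `W_{m−2}ᴴW_{m−2} ≤ B_m·𝟙`,
via `MPSCoarseGraining.re_trace_cgState_le_of_loewner` / `norm_cgState_apply_le_of_loewner`).
No model, no definition, no `sorry`, no new axiom, no named fact.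
[cite: KullEtAl2024, §2.3–2.5 eqs. (TNoneStepRelaxation), (TNfullRelax5); §4.2 eqs. (MPSextension), (relaxLocTIn)] [cite: HornJohnson2013, Theorem 5.1.4, §5.6]
-/
import Summits.Ventures.CertifiedManyBodySolver.Transport.MPSPrimalSrotTrace
import HarnessLib

noncomputable section

open Matrix Complex Filter Topology
open scoped ComplexOrder Kronecker BigOperators MatrixOrder
open Literature.Probability.LatticeModels
open Literature.MathematicalPhysics.QuantumLattice
open Literature.MathematicalPhysics.QuantumLattice.HubbardWave0
open Literature.MathematicalPhysics.QuantumLattice.ThermodynamicLimit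
open Literature.MathematicalPhysics.QuantumLattice.JordanWigner
open Literature.MathematicalPhysics.QuantumManyBody.StateRelaxation
open Literature.MathematicalPhysics.QuantumLattice.MPSCoarseGraining
open Literature.Computability.QuantumComplexity (traceLeft traceRight)

namespace Summit.Ventures.CertifiedManyBodySolver.Transport

/-! ### KSDN's feasible point with a raw head block of `j + 1` sites -/

section Window

variable {β G : Type*} [Fintype β] [DecidableEq β] [AddCommGroup G] {q : ℕ}

/-- **KSDN's feasible point, model-independent core, RAW LEVEL `j + 1`, with the trace bounds** (`N = m'+2 ≥ j+2` sites, `j ≥ 2`). Given a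
real, charge-covariant MPS tensor `A` with a-priori bounds `B_m` (`0 ≤ B_m`, `‖T^{m−2}‖_F² ≤ B_m²`, `m = k+j+2 ≤ N`) and a window variable `ρ ⪰ 0`,
`tr ρ = 1`, `tr_L ρ = tr_R ρ`, block diagonal in the total charge `Σ_x qs(·_x)`, entrywise real — there is a family `ω` such that, with
`ρ_{j+1} := ρ|_{first j+1}` (`headMarginal`): E_{j+2}L, E_{j+2}R (injection `W_j = cgMap A j`), E_mL / E_mR (`m = k+j+3 ≤ N`), `ω_m ⪰ 0`, `cgTag qs qb`
sector zeros, real entries, `|ω_m| ≤ B_m` and `Re tr ω_m ≤ B_m` (`m = k+j+2 ≤ N`). The witness is `ω_m = C_{m−2}(ρ|_{first m})`.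
[cite: KullEtAl2024, §2.3–2.5, §4.2 eqs. (MPSextension), (relaxLocTIn)] -/
theorem exists_mpsRawRowsTr_of_window (j m' : ℕ) (hj : 2 ≤ j) (hjm : j ≤ m') (A : Fin q → Matrix β β ℂ)
    (hAreal : ∀ s a b, star (A s a b) = A s a b) (qs : Fin q → G) (qb : β → G)
    (hAcov : ∀ s a b, A s a b ≠ 0 → qb b = qb a + qs s)
    (B : ℕ → ℝ) (hB : ∀ k, k + (j + 2) ≤ m' + 2 → 0 ≤ B (k + (j + 2)) ∧ frobSq (transferOp A ^ (k + j)) ≤ B (k + (j + 2)) ^ 2)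
    (ρ : Op (Fin (m' + 2)) q) (hpsd : ρ.PosSemidef) (htr : ρ.trace = 1)
    (hLTI : spinPartialTrace (Fin.succEmb (m' + 1)) ρ = spinPartialTrace Fin.castSuccEmb ρ)
    (hsec : ∀ u v : TensorIndex (Fin (m' + 2)) q, (∑ x, qs (u x)) ≠ (∑ x, qs (v x)) → ρ u v = 0)
    (hstar : ∀ u v : TensorIndex (Fin (m' + 2)) q, star (ρ u v) = ρ u v) :
    ∃ ω : ℕ → Matrix (Fin q × ((β × β) × Fin q)) (Fin q × ((β × β) × Fin q)) ℂ,
      traceLeft (ω (j + 2)) = (cgMap A j ⊗ₖ (1 : Matrix (Fin q) (Fin q) ℂ)) *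
          (headMarginal (show j + 1 ≤ m' + 2 by omega) ρ).submatrix
            ((Equiv.prodComm _ _).trans (Fin.snocEquiv fun _ => Fin q))
            ((Equiv.prodComm _ _).trans (Fin.snocEquiv fun _ => Fin q)) *
        (cgMap A j ⊗ₖ (1 : Matrix (Fin q) (Fin q) ℂ))ᴴ ∧
      traceRight ((ω (j + 2)).submatrix (Equiv.prodAssoc _ _ _) (Equiv.prodAssoc _ _ _)) =
        ((1 : Matrix (Fin q) (Fin q) ℂ) ⊗ₖ cgMap A j) *
          (headMarginal (show j + 1 ≤ m' + 2 by omega) ρ).submatrix (Fin.consEquiv fun _ => Fin q)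
            (Fin.consEquiv fun _ => Fin q) *
        ((1 : Matrix (Fin q) (Fin q) ℂ) ⊗ₖ cgMap A j)ᴴ ∧
      (∀ k, k + (j + 3) ≤ m' + 2 → traceLeft (ω (k + (j + 3))) =
        (leftMap A ⊗ₖ (1 : Matrix (Fin q) (Fin q) ℂ)) *
          (ω (k + (j + 2))).submatrix (Equiv.prodAssoc _ _ _) (Equiv.prodAssoc _ _ _) *
        (leftMap A ⊗ₖ (1 : Matrix (Fin q) (Fin q) ℂ))ᴴ) ∧
      (∀ k, k + (j + 3) ≤ m' + 2 → traceRight ((ω (k + (j + 3))).submatrix (Equiv.prodAssoc _ _ _) (Equiv.prodAssoc _ _ _)) =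
        ((1 : Matrix (Fin q) (Fin q) ℂ) ⊗ₖ rightMap A) * ω (k + (j + 2)) *
        ((1 : Matrix (Fin q) (Fin q) ℂ) ⊗ₖ rightMap A)ᴴ) ∧
      (∀ k, k + (j + 2) ≤ m' + 2 → (ω (k + (j + 2))).PosSemidef) ∧
      (∀ k, k + (j + 2) ≤ m' + 2 → ∀ i i', cgTag qs qb i ≠ cgTag qs qb i' → ω (k + (j + 2)) i i' = 0) ∧
      (∀ k, k + (j + 2) ≤ m' + 2 → ∀ i i', starRingEnd ℂ (ω (k + (j + 2)) i i') = ω (k + (j + 2)) i i') ∧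
      (∀ k, k + (j + 2) ≤ m' + 2 → ∀ i i', ‖ω (k + (j + 2)) i i'‖ ≤ B (k + (j + 2))) ∧
      (∀ k, k + (j + 2) ≤ m' + 2 → ((ω (k + (j + 2))).trace).re ≤ B (k + (j + 2))) := by
  classical
  have hj1 : j + 1 ≤ m' + 2 := by omega
  have hj2 : j + 2 ≤ m' + 2 := by omega
  -- head marginals: states, real, sectored
  have hHpsd : ∀ {m} (h : m ≤ m' + 2), (headMarginal h ρ).PosSemidef := fun h => posSemidef_headMarginal h hpsd
  have hHtr : ∀ {m} (h : m ≤ m' + 2), (headMarginal h ρ).trace = 1 := fun h => by rw [trace_headMarginal, htr]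
  have hHstar : ∀ {m} (h : m ≤ m' + 2) (t s : TensorIndex (Fin m) q),
      star (headMarginal h ρ t s) = headMarginal h ρ t s := fun h t s => star_headMarginal_apply hstar h t s
  have hHsec : ∀ {m} (h : m ≤ m' + 2) (u v : TensorIndex (Fin m) q),
      (∑ x, qs (u x)) ≠ (∑ x, qs (v x)) → headMarginal h ρ u v = 0 := fun h u v huv =>
    headMarginal_apply_eq_zero_of_charge qs h hsec huv
  -- the witness `ω_m = C_{m-2}(ρ|_m)` for `j+2 ≤ m ≤ m'+2`, zero elsewhere
  set ω : ℕ → Matrix (Fin q × ((β × β) × Fin q)) (Fin q × ((β × β) × Fin q)) ℂ :=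
    fun m => if h : j + 2 ≤ m ∧ m ≤ m' + 2 then
      cgState A (m - 2) (headMarginal (show m - 2 + 2 ≤ m' + 2 by omega) ρ) else 0 with hωdef
  have hωj' : ω (j + 2) = cgState A j (headMarginal hj2 ρ) :=
    dif_pos (show j + 2 ≤ j + 2 ∧ j + 2 ≤ m' + 2 from ⟨le_rfl, hj2⟩)
  have hωj : ∀ k (hk : k + (j + 2) ≤ m' + 2), ω (k + (j + 2)) = cgState A (k + j) (headMarginal hk ρ) := fun k hk =>
    dif_pos (show j + 2 ≤ k + (j + 2) ∧ k + (j + 2) ≤ m' + 2 from ⟨by omega, hk⟩)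
  have hωj3 : ∀ k (hk : k + (j + 3) ≤ m' + 2), ω (k + (j + 3)) = cgState A (k + j + 1) (headMarginal hk ρ) := fun k hk =>
    dif_pos (show j + 2 ≤ k + (j + 3) ∧ k + (j + 3) ≤ m' + 2 from ⟨by omega, hk⟩)
  refine ⟨ω, ?_, ?_, ?_, ?_, ?_, ?_, ?_, ?_, ?_⟩
  · -- E_{j+2}L: `tr_L ρ_{j+2} = ρ_{j+1}` by LTI
    have e2 : spinPartialTrace (Fin.succEmb (j + 1)) (headMarginal hj2 ρ) = headMarginal hj1 ρ :=
      spinPartialTrace_succEmb_headMarginal hLTI (show j + 1 ≤ m' + 1 by omega)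
    calc traceLeft (ω (j + 2)) = traceLeft (cgState A j (headMarginal hj2 ρ)) := by rw [hωj']
      _ = (cgMap A j ⊗ₖ (1 : Matrix (Fin q) (Fin q) ℂ)) *
            (spinPartialTrace (Fin.succEmb (j + 1)) (headMarginal hj2 ρ)).submatrix
              ((Equiv.prodComm _ _).trans (Fin.snocEquiv fun _ => Fin q))
              ((Equiv.prodComm _ _).trans (Fin.snocEquiv fun _ => Fin q)) *
          (cgMap A j ⊗ₖ (1 : Matrix (Fin q) (Fin q) ℂ))ᴴ := traceLeft_cgState A j _
      _ = _ := by rw [e2]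
  · -- E_{j+2}R: `tr_R ρ_{j+2} = ρ_{j+1}`
    have e2 : spinPartialTrace Fin.castSuccEmb (headMarginal hj2 ρ) = headMarginal hj1 ρ :=
      spinPartialTrace_castSuccEmb_headMarginal hj2 ρ
    calc traceRight ((ω (j + 2)).submatrix (Equiv.prodAssoc _ _ _) (Equiv.prodAssoc _ _ _))
        = traceRight ((cgState A j (headMarginal hj2 ρ)).submatrix (Equiv.prodAssoc _ _ _) (Equiv.prodAssoc _ _ _)) := by
          rw [hωj']
      _ = ((1 : Matrix (Fin q) (Fin q) ℂ) ⊗ₖ cgMap A j) *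
            (spinPartialTrace Fin.castSuccEmb (headMarginal hj2 ρ)).submatrix (Fin.consEquiv fun _ => Fin q)
              (Fin.consEquiv fun _ => Fin q) *
          ((1 : Matrix (Fin q) (Fin q) ℂ) ⊗ₖ cgMap A j)ᴴ := traceRight_cgState_submatrix_prodAssoc A j _
      _ = _ := by rw [e2]
  · -- E_mL
    intro k hk3
    have hk2 : k + (j + 2) ≤ m' + 2 := by omega
    have hkM : k + j + 2 ≤ m' + 1 := by omega
    rw [hωj3 k hk3, hωj k hk2]
    exact traceLeft_cgState_headMarginal A (k + j) hLTI hkM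
  · -- E_mR
    intro k hk3
    have hk2 : k + (j + 2) ≤ m' + 2 := by omega
    have hkM : k + j + 2 ≤ m' + 1 := by omega
    rw [hωj3 k hk3, hωj k hk2]
    exact traceRight_cgState_headMarginal A (k + j) ρ hkM
  · -- PSD
    intro k hk
    rw [hωj k hk]
    exact posSemidef_cgState A (k + j) (hHpsd hk)
  · -- sectors
    intro k hk i i' hii'
    rw [hωj k hk]
    exact cgState_apply_eq_zero_of_cgTag_ne (qs := qs) hAcov (k + j) (hHsec hk) i i' hii'
  · -- real entries
    intro k hk i i'
    rw [hωj k hk, starRingEnd_apply]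
    exact star_cgState_apply hAreal (k + j) (hHstar hk) i i'
  · -- a-priori bounds
    intro k hk i i'
    rw [hωj k hk]
    exact norm_cgState_apply_le_of_transferOp A (k + j) (hHpsd hk) (hHtr hk) (hB k hk).1 (hB k hk).2 i i'
  · -- trace bounds `Re tr ω_m ≤ ‖W_{m-2} W_{m-2}ᴴ‖_F = ‖T^{m-2}‖_F ≤ B_m`
    intro k hk
    rw [hωj k hk]
    refine (re_trace_cgState_le A (k + j) (hHpsd hk) (hHtr hk)).trans ?_
    rw [frobSq_cgMap_mul_conjTranspose]
    exact (Real.sqrt_le_sqrt (hB k hk).2).trans_eq (Real.sqrt_sq (hB k hk).1)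

/-- **The same feasible point under the `λ_max` (Löwner) bound rule** (FORMAT-ksdn v0.5 `lmax_psd`, the rule of the `.lmax` instances, e.g.
CERTIFIED #349): a-priori bounds `B_m` with `0 ≤ B_m` and `W_{m−2}ᴴ W_{m−2} ≤ B_m·𝟙` (`m = k+j+2 ≤ N`; the readers re-certify this exactly)
instead of the Frobenius rule; the entry and trace bounds then come from `MPSCoarseGraining.norm_cgState_apply_le_of_loewner` /
`re_trace_cgState_le_of_loewner`. Given a real, charge-covariant MPS tensor `A` and a window variable `ρ ⪰ 0`,
`tr ρ = 1`, `tr_L ρ = tr_R ρ`, block diagonal in the total charge `Σ_x qs(·_x)`, entrywise real — there is a family `ω` such that, with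
`ρ_{j+1} := ρ|_{first j+1}` (`headMarginal`): E_{j+2}L, E_{j+2}R (injection `W_j = cgMap A j`), E_mL / E_mR (`m = k+j+3 ≤ N`), `ω_m ⪰ 0`, `cgTag qs qb`
sector zeros, real entries, `|ω_m| ≤ B_m` and `Re tr ω_m ≤ B_m` (`m = k+j+2 ≤ N`). The witness is `ω_m = C_{m−2}(ρ|_{first m})`.
[cite: KullEtAl2024, §2.3–2.5, §4.2 eqs. (MPSextension), (relaxLocTIn)] -/
theorem exists_mpsRawRowsTr_of_window_loewner (j m' : ℕ) (hj : 2 ≤ j) (hjm : j ≤ m') (A : Fin q → Matrix β β ℂ)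
    (hAreal : ∀ s a b, star (A s a b) = A s a b) (qs : Fin q → G) (qb : β → G)
    (hAcov : ∀ s a b, A s a b ≠ 0 → qb b = qb a + qs s)
    (B : ℕ → ℝ) (hB : ∀ k, k + (j + 2) ≤ m' + 2 → 0 ≤ B (k + (j + 2)) ∧
      (cgMap A (k + j))ᴴ * cgMap A (k + j) ≤ B (k + (j + 2)) • (1 : Matrix (Fin (k + j) → Fin q) (Fin (k + j) → Fin q) ℂ))
    (ρ : Op (Fin (m' + 2)) q) (hpsd : ρ.PosSemidef) (htr : ρ.trace = 1)
    (hLTI : spinPartialTrace (Fin.succEmb (m' + 1)) ρ = spinPartialTrace Fin.castSuccEmb ρ)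
    (hsec : ∀ u v : TensorIndex (Fin (m' + 2)) q, (∑ x, qs (u x)) ≠ (∑ x, qs (v x)) → ρ u v = 0)
    (hstar : ∀ u v : TensorIndex (Fin (m' + 2)) q, star (ρ u v) = ρ u v) :
    ∃ ω : ℕ → Matrix (Fin q × ((β × β) × Fin q)) (Fin q × ((β × β) × Fin q)) ℂ,
      traceLeft (ω (j + 2)) = (cgMap A j ⊗ₖ (1 : Matrix (Fin q) (Fin q) ℂ)) *
          (headMarginal (show j + 1 ≤ m' + 2 by omega) ρ).submatrix
            ((Equiv.prodComm _ _).trans (Fin.snocEquiv fun _ => Fin q))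
            ((Equiv.prodComm _ _).trans (Fin.snocEquiv fun _ => Fin q)) *
        (cgMap A j ⊗ₖ (1 : Matrix (Fin q) (Fin q) ℂ))ᴴ ∧
      traceRight ((ω (j + 2)).submatrix (Equiv.prodAssoc _ _ _) (Equiv.prodAssoc _ _ _)) =
        ((1 : Matrix (Fin q) (Fin q) ℂ) ⊗ₖ cgMap A j) *
          (headMarginal (show j + 1 ≤ m' + 2 by omega) ρ).submatrix (Fin.consEquiv fun _ => Fin q)
            (Fin.consEquiv fun _ => Fin q) *
        ((1 : Matrix (Fin q) (Fin q) ℂ) ⊗ₖ cgMap A j)ᴴ ∧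
      (∀ k, k + (j + 3) ≤ m' + 2 → traceLeft (ω (k + (j + 3))) =
        (leftMap A ⊗ₖ (1 : Matrix (Fin q) (Fin q) ℂ)) *
          (ω (k + (j + 2))).submatrix (Equiv.prodAssoc _ _ _) (Equiv.prodAssoc _ _ _) *
        (leftMap A ⊗ₖ (1 : Matrix (Fin q) (Fin q) ℂ))ᴴ) ∧
      (∀ k, k + (j + 3) ≤ m' + 2 → traceRight ((ω (k + (j + 3))).submatrix (Equiv.prodAssoc _ _ _) (Equiv.prodAssoc _ _ _)) =
        ((1 : Matrix (Fin q) (Fin q) ℂ) ⊗ₖ rightMap A) * ω (k + (j + 2)) *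
        ((1 : Matrix (Fin q) (Fin q) ℂ) ⊗ₖ rightMap A)ᴴ) ∧
      (∀ k, k + (j + 2) ≤ m' + 2 → (ω (k + (j + 2))).PosSemidef) ∧
      (∀ k, k + (j + 2) ≤ m' + 2 → ∀ i i', cgTag qs qb i ≠ cgTag qs qb i' → ω (k + (j + 2)) i i' = 0) ∧
      (∀ k, k + (j + 2) ≤ m' + 2 → ∀ i i', starRingEnd ℂ (ω (k + (j + 2)) i i') = ω (k + (j + 2)) i i') ∧
      (∀ k, k + (j + 2) ≤ m' + 2 → ∀ i i', ‖ω (k + (j + 2)) i i'‖ ≤ B (k + (j + 2))) ∧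
      (∀ k, k + (j + 2) ≤ m' + 2 → ((ω (k + (j + 2))).trace).re ≤ B (k + (j + 2))) := by
  classical
  have hj1 : j + 1 ≤ m' + 2 := by omega
  have hj2 : j + 2 ≤ m' + 2 := by omega
  -- head marginals: states, real, sectored
  have hHpsd : ∀ {m} (h : m ≤ m' + 2), (headMarginal h ρ).PosSemidef := fun h => posSemidef_headMarginal h hpsd
  have hHtr : ∀ {m} (h : m ≤ m' + 2), (headMarginal h ρ).trace = 1 := fun h => by rw [trace_headMarginal, htr]
  have hHstar : ∀ {m} (h : m ≤ m' + 2) (t s : TensorIndex (Fin m) q),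
      star (headMarginal h ρ t s) = headMarginal h ρ t s := fun h t s => star_headMarginal_apply hstar h t s
  have hHsec : ∀ {m} (h : m ≤ m' + 2) (u v : TensorIndex (Fin m) q),
      (∑ x, qs (u x)) ≠ (∑ x, qs (v x)) → headMarginal h ρ u v = 0 := fun h u v huv =>
    headMarginal_apply_eq_zero_of_charge qs h hsec huv
  -- the witness `ω_m = C_{m-2}(ρ|_m)` for `j+2 ≤ m ≤ m'+2`, zero elsewhere
  set ω : ℕ → Matrix (Fin q × ((β × β) × Fin q)) (Fin q × ((β × β) × Fin q)) ℂ :=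
    fun m => if h : j + 2 ≤ m ∧ m ≤ m' + 2 then
      cgState A (m - 2) (headMarginal (show m - 2 + 2 ≤ m' + 2 by omega) ρ) else 0 with hωdef
  have hωj' : ω (j + 2) = cgState A j (headMarginal hj2 ρ) :=
    dif_pos (show j + 2 ≤ j + 2 ∧ j + 2 ≤ m' + 2 from ⟨le_rfl, hj2⟩)
  have hωj : ∀ k (hk : k + (j + 2) ≤ m' + 2), ω (k + (j + 2)) = cgState A (k + j) (headMarginal hk ρ) := fun k hk =>
    dif_pos (show j + 2 ≤ k + (j + 2) ∧ k + (j + 2) ≤ m' + 2 from ⟨by omega, hk⟩)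
  have hωj3 : ∀ k (hk : k + (j + 3) ≤ m' + 2), ω (k + (j + 3)) = cgState A (k + j + 1) (headMarginal hk ρ) := fun k hk =>
    dif_pos (show j + 2 ≤ k + (j + 3) ∧ k + (j + 3) ≤ m' + 2 from ⟨by omega, hk⟩)
  refine ⟨ω, ?_, ?_, ?_, ?_, ?_, ?_, ?_, ?_, ?_⟩
  · -- E_{j+2}L: `tr_L ρ_{j+2} = ρ_{j+1}` by LTI
    have e2 : spinPartialTrace (Fin.succEmb (j + 1)) (headMarginal hj2 ρ) = headMarginal hj1 ρ :=
      spinPartialTrace_succEmb_headMarginal hLTI (show j + 1 ≤ m' + 1 by omega)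
    calc traceLeft (ω (j + 2)) = traceLeft (cgState A j (headMarginal hj2 ρ)) := by rw [hωj']
      _ = (cgMap A j ⊗ₖ (1 : Matrix (Fin q) (Fin q) ℂ)) *
            (spinPartialTrace (Fin.succEmb (j + 1)) (headMarginal hj2 ρ)).submatrix
              ((Equiv.prodComm _ _).trans (Fin.snocEquiv fun _ => Fin q))
              ((Equiv.prodComm _ _).trans (Fin.snocEquiv fun _ => Fin q)) *
          (cgMap A j ⊗ₖ (1 : Matrix (Fin q) (Fin q) ℂ))ᴴ := traceLeft_cgState A j _
      _ = _ := by rw [e2]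
  · -- E_{j+2}R: `tr_R ρ_{j+2} = ρ_{j+1}`
    have e2 : spinPartialTrace Fin.castSuccEmb (headMarginal hj2 ρ) = headMarginal hj1 ρ :=
      spinPartialTrace_castSuccEmb_headMarginal hj2 ρ
    calc traceRight ((ω (j + 2)).submatrix (Equiv.prodAssoc _ _ _) (Equiv.prodAssoc _ _ _))
        = traceRight ((cgState A j (headMarginal hj2 ρ)).submatrix (Equiv.prodAssoc _ _ _) (Equiv.prodAssoc _ _ _)) := by
          rw [hωj']
      _ = ((1 : Matrix (Fin q) (Fin q) ℂ) ⊗ₖ cgMap A j) *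
            (spinPartialTrace Fin.castSuccEmb (headMarginal hj2 ρ)).submatrix (Fin.consEquiv fun _ => Fin q)
              (Fin.consEquiv fun _ => Fin q) *
          ((1 : Matrix (Fin q) (Fin q) ℂ) ⊗ₖ cgMap A j)ᴴ := traceRight_cgState_submatrix_prodAssoc A j _
      _ = _ := by rw [e2]
  · -- E_mL
    intro k hk3
    have hk2 : k + (j + 2) ≤ m' + 2 := by omega
    have hkM : k + j + 2 ≤ m' + 1 := by omega
    rw [hωj3 k hk3, hωj k hk2]
    exact traceLeft_cgState_headMarginal A (k + j) hLTI hkM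
  · -- E_mR
    intro k hk3
    have hk2 : k + (j + 2) ≤ m' + 2 := by omega
    have hkM : k + j + 2 ≤ m' + 1 := by omega
    rw [hωj3 k hk3, hωj k hk2]
    exact traceRight_cgState_headMarginal A (k + j) ρ hkM
  · -- PSD
    intro k hk
    rw [hωj k hk]
    exact posSemidef_cgState A (k + j) (hHpsd hk)
  · -- sectors
    intro k hk i i' hii'
    rw [hωj k hk]
    exact cgState_apply_eq_zero_of_cgTag_ne (qs := qs) hAcov (k + j) (hHsec hk) i i' hii'
  · -- real entries
    intro k hk i i'
    rw [hωj k hk, starRingEnd_apply]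
    exact star_cgState_apply hAreal (k + j) (hHstar hk) i i'
  · -- a-priori bounds, `λ_max` rule
    intro k hk i i'
    rw [hωj k hk]
    exact norm_cgState_apply_le_of_loewner A (k + j) (hHpsd hk) (hHtr hk) (hB k hk).1 (hB k hk).2 i i'
  · -- trace bounds `Re tr ω_m ≤ r_m` from `W_{m-2}ᴴ W_{m-2} ≤ r_m·𝟙`
    intro k hk
    rw [hωj k hk]
    exact re_trace_cgState_le_of_loewner A (k + j) (hHpsd hk) (hHtr hk) (hB k hk).1 (hB k hk).2

end Window

end Summit.Ventures.CertifiedManyBodySolver.Transport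

end
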